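import Mathlib
import HarnessLib
import Literature.Analysis.FluidPDE.SelfSimilar
import Literature.Analysis.FluidPDE.VectorCalculus
import Literature.Analysis.FluidPDE.VorticityCalculus
import Literature.Analysis.FluidPDE.NSBoundedMildOseen
import Literature.Analysis.FluidPDE.SuitableWeak
import Literature.Analysis.FluidPDE.WeakSolution
import Literature.Analysis.FluidPDE.LocalTypeI
import Literature.Analysis.UnboundedOperators.HeatKernel
import Summits.NavierStokesRegularity.NavierStokesRegularity.Theorems.LocalSineTubeDoorProfileAlignedWindowRigidityAncient

/-!
# `FilamentPinchDoor.FilamentPinchLiouville` (stmt-NavierStokesRegularity-26430) — line `birth` (skeleton r1),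
# stub `stub_windowMass` PROVED: the scale-normalised windowed mass of a one-signed vorticity component with
# FILAMENTARY (linear) ball growth is bounded uniformly in scale, centre and time

Registered stub of the skeleton of record (lead skeleton r1 of crux 26430, sha16 20d6c446…, item evidence #2;
planner ns-idea-6 g3 birth composition «window mass + frozen windowed circulation ⇒ pinch exclusion» with the stub
statements unfolded and the Gaussian window replaced by an arbitrary compactly supported window), VERBATIM, so the
line's `sorry` at `stub_windowMass` closes by
`exact …Theorems.FilamentPinchDoorFilamentPinchLiouvilleStubWindowMass.stub_windowMass`.

STATEMENT.  For a profile `v` of the route's class (Type-I rate, continuous on the open backward slab, Oseen-mild,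
divergence-free, suitable on the backward slab with `𝐈 < ∞`), a direction `e ≠ 0` with `ω_e := ⟪curl v(s,·), e⟫ ≥ 0`
everywhere and linear ball growth `∫_{B(x,R)} ω_e(s) ≤ K·R` (all `s<0`, `x`, `R>0`), and every continuous compactly
supported window profile `φ`, there is `K₁` with
`|L⁻¹ ∫ ω_e(s,y) φ((y−a)/L) dy| ≤ K₁` for all `L > 0`, `a ∈ ℝ³`, `s < 0`.

PROOF (the provable-first stub; three lines).  `|φ| ≤ M` and `φ = 0` off `B(0,R₀)`, so the scaled window
`φ((·−a)/L)` lives in `B(a, R₀L)` and `|∫ ω_e φ_L| ≤ M ∫_{B(a,R₀L)} ω_e ≤ M·|K|·R₀·L` (the sign makes `|ω_e φ_L| ≤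
M·𝟙_B·ω_e` a genuine majorant); divide by `L`: `K₁ = M|K|R₀`.  Slices of the class are real-analytic (tree
`…LocalSineTubeDoorProfileAlignedWindowRigidityAncient.analyticOnNhd_slice`), so `ω_e(s,·)` is continuous and every
integral is a proper one.  Scale invariance: `K` and `K₁` are dimensionless (mass/length).

HONEST FRAMING: a bookkeeping lemma about HYPOTHETICAL blow-up profiles (slices of a putative Type-I singularity's
energy-class profile with a one-signed vorticity component); nothing here bears on Navier–Stokes regularity; no
summit statement is proved.
-/

noncomputable section

-- the summit and its single sub-problem share the name (CONVENTIONS §1), as in every Theorems file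
set_option linter.dupNamespace false

namespace Summit.NavierStokesRegularity.NavierStokesRegularity.Theorems.FilamentPinchDoorFilamentPinchLiouvilleStubWindowMass

open Set Function Filter MeasureTheory Metric Topology InnerProductSpace
open scoped ENNReal NNReal RealInnerProductSpace
open Literature.Analysis Literature.Analysis.FluidPDE
open Summit.NavierStokesRegularity.NavierStokesRegularity.Theorems.LocalSineTubeDoorProfileAlignedWindowRigidityAncient

/-! ### The windowed mass of a non-negative density with linear ball growth -/

/-- **Windowed mass bound (kinematic core).**  If `ω ≥ 0` is continuous with `∫_{B(x,R)} ω ≤ K·R` (in `ℝ≥0∞` form)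
for all centres and radii, and `φ` is a window with `|φ| ≤ M` vanishing outside `B(0,R₀)` (`R₀ > 0`), then
`|L⁻¹ ∫ ω(y) φ(L⁻¹(y−a)) dy| ≤ M·|K|·R₀` for every `L > 0` and `a`. [folklore] -/
theorem abs_inv_mul_integral_mul_window_le {ω φ : EuclideanSpace ℝ (Fin 3) → ℝ} (hωc : Continuous ω)
    (hω0 : ∀ y, 0 ≤ ω y) {K : ℝ}
    (hK : ∀ (x : EuclideanSpace ℝ (Fin 3)) (R : ℝ), 0 < R →
      ∫⁻ y in ball x R, ENNReal.ofReal (ω y) ≤ ENNReal.ofReal (K * R))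
    {M R₀ : ℝ} (hM : ∀ z, ‖φ z‖ ≤ M) (hR₀ : 0 < R₀) (hsupp : ∀ z, R₀ ≤ ‖z‖ → φ z = 0)
    {L : ℝ} (hL : 0 < L) (a : EuclideanSpace ℝ (Fin 3)) :
    |L⁻¹ * ∫ y, ω y * φ (L⁻¹ • (y - a))| ≤ M * |K| * R₀ := by
  have hM0 : 0 ≤ M := (norm_nonneg _).trans (hM 0)
  have hRL : 0 < R₀ * L := mul_pos hR₀ hL
  -- the scaled window lives in `B(a, R₀ L)`
  have hφL : ∀ y, y ∉ ball a (R₀ * L) → φ (L⁻¹ • (y - a)) = 0 := by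
    intro y hy
    apply hsupp
    rw [mem_ball, dist_eq_norm, not_lt] at hy
    rw [norm_smul, norm_inv, Real.norm_of_nonneg hL.le]
    rw [le_inv_mul_iff₀' hL]
    linarith
  -- pointwise majorant
  have hpt : ∀ y, |ω y * φ (L⁻¹ • (y - a))| ≤ (ball a (R₀ * L)).indicator (fun y => M * ω y) y := by
    intro y
    by_cases hy : y ∈ ball a (R₀ * L)
    · rw [indicator_of_mem hy, abs_mul, abs_of_nonneg (hω0 y), mul_comm]
      exact mul_le_mul_of_nonneg_right ((Real.norm_eq_abs _).symm.le.trans (hM _)) (hω0 y)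
    · rw [indicator_of_notMem hy, hφL y hy, mul_zero, abs_zero]
  -- the majorant is integrable (continuous on a compact ball)
  have hint : Integrable ((ball a (R₀ * L)).indicator fun y => M * ω y) := by
    rw [integrable_indicator_iff measurableSet_ball]
    exact ((continuous_const.mul hωc).continuousOn.integrableOn_compact
      (isCompact_closedBall a (R₀ * L))).mono_set ball_subset_closedBall
  have h1 : |∫ y, ω y * φ (L⁻¹ • (y - a))| ≤ M * ∫ y in ball a (R₀ * L), ω y := by
    calc |∫ y, ω y * φ (L⁻¹ • (y - a))| ≤ ∫ y, |ω y * φ (L⁻¹ • (y - a))| :=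
          abs_integral_le_integral_abs
      _ ≤ ∫ y, (ball a (R₀ * L)).indicator (fun y => M * ω y) y :=
          integral_mono_of_nonneg (Eventually.of_forall fun y => abs_nonneg _) hint
            (Eventually.of_forall hpt)
      _ = M * ∫ y in ball a (R₀ * L), ω y := by
          rw [integral_indicator measurableSet_ball, integral_const_mul]
  -- the ball mass is at most `|K| R₀ L`
  have h2 : ∫ y in ball a (R₀ * L), ω y ≤ |K| * (R₀ * L) := by
    rw [integral_eq_lintegral_of_nonneg_ae (Eventually.of_forall fun y => hω0 y)
      hωc.aestronglyMeasurable]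
    calc (∫⁻ y in ball a (R₀ * L), ENNReal.ofReal (ω y)).toReal
        ≤ (ENNReal.ofReal (K * (R₀ * L))).toReal :=
          ENNReal.toReal_mono ENNReal.ofReal_ne_top (hK a (R₀ * L) hRL)
      _ ≤ |K| * (R₀ * L) := by
          rw [ENNReal.toReal_ofReal']
          exact max_le (mul_le_mul_of_nonneg_right (le_abs_self K) hRL.le) (by positivity)
  rw [abs_mul, abs_inv, abs_of_pos hL]
  calc L⁻¹ * |∫ y, ω y * φ (L⁻¹ • (y - a))| ≤ L⁻¹ * (M * (|K| * (R₀ * L))) :=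
        mul_le_mul_of_nonneg_left (h1.trans (mul_le_mul_of_nonneg_left h2 hM0)) (inv_nonneg.2 hL.le)
    _ = M * |K| * R₀ := by field_simp

/-! ### The registered stub -/

/-- **Stub `stub_windowMass` of line `birth` (skeleton r1, crux `FilamentPinchLiouville`, stmt-26430), VERBATIM**:
for a profile of the route's energy class with a one-signed vorticity component `⟪curl v, e⟫ ≥ 0` of linear ball
growth, and any continuous compactly supported window profile `φ`, the scale-normalised windowed mass
`L⁻¹ ∫ ⟪curl v(s,y), e⟫ φ((y−a)/L) dy` is bounded uniformly in `L > 0`, `a`, `s < 0`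
(`abs_inv_mul_integral_mul_window_le`; slices are real-analytic so `⟪curl v(s,·), e⟫` is continuous). [folklore] -/
theorem stub_windowMass : ∀ (C : ℝ) (v : ℝ → EuclideanSpace ℝ (Fin 3) → EuclideanSpace ℝ (Fin 3)) (π : ℝ → EuclideanSpace ℝ (Fin 3) → ℝ) (H : ℝ → EuclideanSpace ℝ (Fin 3) → EuclideanSpace ℝ (Fin 3) →L[ℝ] EuclideanSpace ℝ (Fin 3)), Literature.Analysis.FluidPDE.HasTypeITimeDecay C v → ContinuousOn (Function.uncurry v) (Set.Iio (0 : ℝ) ×ˢ Set.univ) → (∀ s t : ℝ, s < t → t < 0 → ∀ x, v t x = Literature.Analysis.UnboundedOperators.heatExtension (v s) (t - s) x - Literature.Analysis.FluidPDE.oseenDuhamel 1 s v v t x) → (∀ t < 0, Literature.Analysis.FluidPDE.VectorCalculus.IsDivFree (v t)) → Literature.Analysis.FluidPDE.IsSuitableWeakSolutionOn (Literature.Analysis.FluidPDE.slab (EuclideanSpace ℝ (Fin 3)) (Set.Iio (0 : ℝ)) isOpen_Iio) 1 0 v π → Literature.Analysis.FluidPDE.HasWeakSpatialGradientOn (Literature.Analysis.FluidPDE.slab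 (EuclideanSpace ℝ (Fin 3)) (Set.Iio (0 : ℝ)) isOpen_Iio) v H → Literature.Analysis.FluidPDE.typeIBound (Set.Iio (0 : ℝ) ×ˢ Set.univ) v π H < ⊤ → ∀ (e : EuclideanSpace ℝ (Fin 3)), e ≠ 0 → (∀ s < 0, ∀ y, 0 ≤ ⟪Literature.Analysis.FluidPDE.curl (v s) y, e⟫_ℝ) → (∃ K : ℝ, ∀ s < 0, ∀ (x : EuclideanSpace ℝ (Fin 3)) (R : ℝ), 0 < R → ∫⁻ y in Metric.ball x R, ENNReal.ofReal ⟪Literature.Analysis.FluidPDE.curl (v s) y, e⟫_ℝ ≤ ENNReal.ofReal (K * R)) → ∀ (φ : EuclideanSpace ℝ (Fin 3) → ℝ), Continuous φ → HasCompactSupport φ → ∃ K₁ : ℝ, ∀ L : ℝ, 0 < L → ∀ (a : EuclideanSpace ℝ (Fin 3)), ∀ s < 0, |L⁻¹ * ∫ y, ⟪Literature.Analysis.FluidPDE.curl (v s) y, e⟫_ℝ * φ (L⁻¹ • (y - a))| ≤ K₁ := by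
  intro C v π H hrate hcont hmild _ _ _ _ e _ hnn hK φ hφ hφc
  obtain ⟨K, hK⟩ := hK
  obtain ⟨M, hM⟩ := hφc.exists_bound_of_continuous hφ
  obtain ⟨R₀, hR₀, hsupp⟩ := hφc.exists_pos_le_norm
  refine ⟨M * |K| * R₀, fun L hL a s hs => ?_⟩
  have hw : ContDiff ℝ 1 (v s) :=
    (analyticOnNhd_slice hcont (bdd_of_hasTypeITimeDecay hrate) hmild hs).contDiff
  have hωc : Continuous fun y => ⟪curl (v s) y, e⟫ := (continuous_curl hw).inner continuous_const
  exact abs_inv_mul_integral_mul_window_le hωc (hnn s hs) (fun x R hR => hK s hs x R hR) hM hR₀ hsupp hL a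

end Summit.NavierStokesRegularity.NavierStokesRegularity.Theorems.FilamentPinchDoorFilamentPinchLiouvilleStubWindowMass

end
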